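import Mathlib
import HarnessLib
import Literature.MathematicalPhysics.QuantumFieldTheory.Balaban1983to89.B10Eq65PolymerSum

/-!
# `Balaban1983to89.B10Thm2Exactness` — [Balaban1985UV3] p. 272, the exactness sentence of the proof of
# **Theorem 2**: *"To get the exact inequality we estimate a sum of all terms 𝒫_j(Y_j, U_{k+1}) with localizations Y_j
# not contained in Ω_{k+1} by O(1)|Λ_k|, or by O(1)|Z_k|."* — PROVED at one scale over the cube carriers of
# `B12TreeDecay`: the polymers NOT CONTAINED in a block set `Ω` are exactly those TOUCHING its complement, and the
# touching form of (1.26) bounds their activity sum by `O(1)·#(blocks ∖ Ω)`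

T. Bałaban, *Ultraviolet stability of three-dimensional lattice pure gauge field theories*, Commun. Math. Phys. **102**,
255–275 (1985) [Balaban1985UV3] (cell paper B10; lit key `paper:balaban1985-cmp102-uv-stability-3d`, journal page =
PDF page + 254; page re-read for this file on the render
`run/shared/lean/pub/pub-balaban/b2b-balaban-ref1/pages/1985-cmp102-uv-stability-3d/…-p018-x2.png` (p. 272), 2026-08-21).

HONEST FRAMING (mega-formalization `lit-balaban`, verbatim): statement-level skeleton of published theorems with
citation tags; proofs where landed; nothing here is a claim about the Yang–Mills mass gap.

WHY THIS FILE EXISTS.  Unit `lit-balaban-r07` (reader/typer of B10), gen 6; SKELETON row B10.Thm2 (its exactness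
step).  The cell module `…B10SectAGathering` carries the sentence as the HYPOTHESIS-SHAPED leaf
`B10SectAGathering.OldOutside P C : ∀ h U, |P.Pold h U − P.PoldIn h U| ≤ C · P.Zvol h` over abstract carriers
(`Pold` = all old interaction terms, `PoldIn` = those with `Y_j ⊂ Ω_{k+1}`, `Zvol` = `|Z_k|`).  This module proves the
sentence AT ONE SCALE for a genuine polymer sum: the localization domains of one scale as connected families of
big blocks (`B12TreeDecay.CubeSystem` over `LocDomainSys`), the activities `𝒫(Y, U)` with a decay bound of the type
(25) p. 262 / (44) p. 267 (`B10.Bound25Printed`: `|𝒫(Y, U)| ≤ C·g·e^{−κ𝓛(Y)}`), and the touching form of (1.26) of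
[Balaban1988RG2Cluster] kernel-checked in `B12TreeDecay.ineq126_touches` ([Dimock2013] Cor. 26: `Σ_{X ∩ W ≠ ∅}
e^{−κd(X)} ≤ K₀|W|`).  The multi-scale resummation over `j = 1, …, k` with the factors `(L^jη)⁴(M₁L^jη)^{−3}` is the
d = 3 power counting of (45)–(46) p. 267, pre-existing (`B10SectCExpansion.bound46_of_bound45`,
`B10.powerCounting_d3`); v1.1 §4 performs exactly this resummation for the dropped terms, in the `OldOutside` shape with `|Z_k|`.

THE PRINTED TEXT (p. 272 [18], verbatim): *"Thus we have estimated ρ_{k+1} by an expression which is almost equal to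
the right-hand side of the inductive assumption (41) for k + 1. To get the exact inequality we estimate a sum of all
terms 𝒫_j(Y_j, U_{k+1}) with localizations Y_j not contained in Ω_{k+1} by O(1)|Λ_k|, or by O(1)|Z_k|. The lower
bound is proved in the same way, with all simplifications coming from the fact that Ω_{k+1} = T_η. Thus we have
proved. Theorem 2."*  Context: (41) p. 266 [12] (the terms `Σ_{j=1}^k Σ_{Y_j} 𝒫_j(Y_j, U_k)`, *"Y_j represents big
blocks of L^jη-lattice, contained in Ω_k"*), (44)–(46) p. 267 [13] (their bounds and resummation), `Z_k = Ω_{k+1}^{(k)c}`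
(40) p. 266, `Λ_k = Ω_k^{(k)} ∖ Ω_{k+1}^{(k)}` (48) p. 268.

DICTIONARY print ↦ Lean.  One scale `j`: the localization domains `Y_j` ↦ `X : S.Dom` (`S : LocDomainSys`, tree length
`S.dj` = 𝓛), their big blocks ↦ `G.cubes X : Finset G.Cube` (`G : CubeSystem S`); `Ω_{k+1}` (as a union of big blocks
of this scale) ↦ a block set `Ω : Finset G.Cube`; *"Y_j not contained in Ω_{k+1}"* ↦ `¬ G.cubes X ⊆ Ω`, equivalently
*"Y_j meets Ω_{k+1}ᶜ"* ↦ `(G.cubes X ∩ (univ ∖ Ω)).Nonempty` (`notSubset_iff_touches_compl`); the activities ↦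
`act : S.Dom → Cfg → ℝ` with `B10.Bound25Printed ⟨S.Dom, Cfg, S.dj, act⟩ g κ C`; `|Z_k|` (or `|Λ_k|`) ↦ any real
`Zvol ≥ #(univ ∖ Ω)` (the blocks outside `Ω` are blocks of `Z_k`; a unit-lattice site count dominates a big-block
count).  The O(1) is `C·g·K₀(c₀,Δ)` (volume-leaf form) or `C·g·K₀(ℓ₀⁻¹,Δ)` (tree-length form), independent of `Ω`, of
the configuration and of the lattice.

WHAT THIS FILE PROVES (kernel, no `sorry`, theorems only, no new definitions or named facts; axioms standard).
* `notSubset_iff_touches_compl`, `filter_notSubset_eq_filter_touches` — *"not contained in Ω"* = *"touching Ωᶜ"*.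
* `sum_abs_act_touching_le_of_bound25` — (25)-type decay ⇒ `Σ_{Y ∩ W ≠ ∅} |𝒫(Y, U)| ≤ C·g·K₀(c₀,Δ)·#W` for every block
  set `W` (wall-degree ≤ Δ, volume leaf, `κ ≥ κ₀(c₀,Δ)`).
* `sum_abs_act_notSubset_le_of_bound25` — **`Σ_{Y ⊄ Ω} |𝒫(Y, U)| ≤ C·g·K₀(c₀,Δ)·#(blocks ∖ Ω)`** (the printed sentence
  at one scale).
* `oldOutside_shape_of_bound25` — the `OldOutside` shape: `|Σ_Y 𝒫(Y,U) − Σ_{Y ⊂ Ω} 𝒫(Y,U)| ≤ (C·g·K₀(c₀,Δ))·Zvol` for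
  any `Zvol ≥ #(blocks ∖ Ω)`.
* `sum_abs_act_notSubset_le_treeLength`, `oldOutside_shape_treeLength` — the same WITHOUT the quoted volume leaf, from
  the elementary tree-length bound `𝓛(Y) ≥ ℓ₀(#blocks(Y) − 1)` (as in `B10Eq65PolymerSum` §7).
* (v1.1, unit `lit-balaban-r07` gen 13; v1 declarations byte-identical) §4 `oldOutside_allScales_of_bound25` — the
  sentence OVER ALL SCALES `j = 1, …, k` of (41): scale-j activities with the (44)–(45) smallness
  `(CM·g·p(g))²(L^jη)⁴` in their (25)-type bound and block counts `#(j-blocks ∖ Ω_j) ≤ (M₁L^jη)^{−3}·|Z_k|` give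
  **`Σ_j |Σ_Y 𝒫_j − Σ_{Y ⊂ Ω_j} 𝒫_j| ≤ C·K₀·CM²·M₁^{−3}·(L/(L−1))·(g p(g))²·|Z_k|`** (`B10.powerCounting_d3`), i.e. the
  printed «by O(1)|Z_k|» with `O(1) = O(M₁³g²p²)·K₀` (`oldOutside_allScales_printed_shape`; the absorption recorded as
  «not written» in the cell census, pub-balaban GAPS G-B10-07 (b), decay-based reading).

Value = SKELETON row B10.Thm2 gains a kernel-checked member (the exactness step at one scale, modulo the (25)/(44)-type
decay leaf); NOT summit progress.
-/

noncomputable section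

open Finset
open Literature.MathematicalPhysics.QuantumFieldTheory.Balaban1983to89
open Literature.MathematicalPhysics.QuantumFieldTheory.Balaban1983to89.B12TreeDecay
  (CubeSystem kappa₀ K₀ K₀_pos ineq126_touches)

namespace Literature.MathematicalPhysics.QuantumFieldTheory.Balaban1983to89.B10Thm2Exactness

/-! ## §1 "Not contained in Ω" = "touching the complement of Ω" -/

section Touching

variable {S : LocDomainSys} (G : CubeSystem S)

/-- *"localizations Y_j not contained in Ω_{k+1}"* (p. 272) ⇔ `Y_j` has a block outside `Ω_{k+1}`, i.e. its family of
blocks meets the complement. [cite: Balaban1985UV3, Thm 2 proof p.272] -/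
theorem notSubset_iff_touches_compl (Ω : Finset G.Cube) (X : S.Dom) :
    ¬ G.cubes X ⊆ Ω ↔ (G.cubes X ∩ (Finset.univ \ Ω)).Nonempty := by
  rw [Finset.not_subset]
  constructor
  · rintro ⟨c, hc, hcΩ⟩
    exact ⟨c, Finset.mem_inter.mpr ⟨hc, Finset.mem_sdiff.mpr ⟨Finset.mem_univ _, hcΩ⟩⟩⟩
  · rintro ⟨c, hc⟩
    obtain ⟨hcX, hc'⟩ := Finset.mem_inter.mp hc
    exact ⟨c, hcX, (Finset.mem_sdiff.mp hc').2⟩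

/-- The two filters agree: domains not contained in `Ω` = domains touching `univ ∖ Ω`. [cite: Balaban1985UV3, Thm 2 proof p.272] -/
theorem filter_notSubset_eq_filter_touches (Ω : Finset G.Cube) :
    (Finset.univ.filter fun X : S.Dom => ¬ G.cubes X ⊆ Ω) =
      Finset.univ.filter fun X : S.Dom => (G.cubes X ∩ (Finset.univ \ Ω)).Nonempty := by
  ext X
  simp only [Finset.mem_filter, Finset.mem_univ, true_and]
  exact notSubset_iff_touches_compl G Ω X

end Touching

/-! ## §2 The touching sum under a (25)/(44)-type decay bound -/

section Bound25

variable {S : LocDomainSys} (G : CubeSystem S) {Δ : ℕ} {c₀ κ g C : ℝ} {Cfg : Type}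

/-- **(25)-type decay ⇒ the activity sum over the polymers TOUCHING a block set `W` is `≤ C·g·K₀(c₀,Δ)·#W`**: termwise
`|𝒫(Y,U)| ≤ C·g·e^{−κ𝓛(Y)}`, then the touching form of (1.26) (`B12TreeDecay.ineq126_touches`, [Dimock2013] Cor. 26).
Hypotheses: wall-degree ≤ Δ, the volume leaf, `κ ≥ κ₀(c₀,Δ)`, `0 ≤ C·g`. [cite: Balaban1985UV3, Thm 2 proof p.272] -/
theorem sum_abs_act_touching_le_of_bound25 (hΔ : G.DegreeLE Δ) (hV : G.VolumeLeaf c₀) (hκ : kappa₀ c₀ Δ ≤ κ)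
    (act : S.Dom → Cfg → ℝ) (hCg : 0 ≤ C * g) (h25 : B10.Bound25Printed ⟨S.Dom, Cfg, S.dj, act⟩ g κ C) (U : Cfg)
    (W : Finset G.Cube) :
    ∑ X ∈ Finset.univ.filter (fun X : S.Dom => (G.cubes X ∩ W).Nonempty), |act X U| ≤ C * g * K₀ c₀ Δ * W.card := by
  calc ∑ X ∈ Finset.univ.filter (fun X : S.Dom => (G.cubes X ∩ W).Nonempty), |act X U|
      ≤ ∑ X ∈ Finset.univ.filter (fun X : S.Dom => (G.cubes X ∩ W).Nonempty), C * g * Real.exp (-κ * S.dj X) :=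
        Finset.sum_le_sum fun X _ => by rw [neg_mul]; exact h25 X U
    _ = C * g * ∑ X ∈ Finset.univ.filter (fun X : S.Dom => (G.cubes X ∩ W).Nonempty), Real.exp (-κ * S.dj X) := by
        rw [Finset.mul_sum]
    _ ≤ C * g * (K₀ c₀ Δ * W.card) := mul_le_mul_of_nonneg_left (ineq126_touches G hΔ hV hκ W) hCg
    _ = C * g * K₀ c₀ Δ * W.card := by ring

/-- **The exactness sentence of the proof of Theorem 2, p. 272, at one scale:** *"we estimate a sum of all terms
𝒫_j(Y_j, U_{k+1}) with localizations Y_j not contained in Ω_{k+1} by O(1)|Λ_k|, or by O(1)|Z_k|"* —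
`Σ_{Y ⊄ Ω} |𝒫(Y, U)| ≤ C·g·K₀(c₀,Δ)·#(blocks ∖ Ω)`, the blocks outside `Ω = Ω_{k+1}` being blocks of `Z_k` (and, for
domains inside `Ω_k`, of `Λ_k`). [cite: Balaban1985UV3, Thm 2 proof p.272] -/
theorem sum_abs_act_notSubset_le_of_bound25 (hΔ : G.DegreeLE Δ) (hV : G.VolumeLeaf c₀) (hκ : kappa₀ c₀ Δ ≤ κ)
    (act : S.Dom → Cfg → ℝ) (hCg : 0 ≤ C * g) (h25 : B10.Bound25Printed ⟨S.Dom, Cfg, S.dj, act⟩ g κ C) (U : Cfg)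
    (Ω : Finset G.Cube) :
    ∑ X ∈ Finset.univ.filter (fun X : S.Dom => ¬ G.cubes X ⊆ Ω), |act X U|
      ≤ C * g * K₀ c₀ Δ * (Finset.univ \ Ω).card := by
  rw [filter_notSubset_eq_filter_touches G Ω]
  exact sum_abs_act_touching_le_of_bound25 G hΔ hV hκ act hCg h25 U (Finset.univ \ Ω)

/-- Splitting the polymer sum: `Σ_Y 𝒫(Y,U) − Σ_{Y ⊂ Ω} 𝒫(Y,U) = Σ_{Y ⊄ Ω} 𝒫(Y,U)`. [cite: Balaban1985UV3, Thm 2 proof p.272] -/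
theorem sum_sub_sum_subset_eq (act : S.Dom → Cfg → ℝ) (U : Cfg) (Ω : Finset G.Cube) :
    ∑ X : S.Dom, act X U - ∑ X ∈ Finset.univ.filter (fun X : S.Dom => G.cubes X ⊆ Ω), act X U =
      ∑ X ∈ Finset.univ.filter (fun X : S.Dom => ¬ G.cubes X ⊆ Ω), act X U := by
  rw [sub_eq_iff_eq_add, ← Finset.sum_filter_add_sum_filter_not Finset.univ (fun X : S.Dom => G.cubes X ⊆ Ω),
    add_comm]

/-- **The shape of the typed leaf `B10SectAGathering.OldOutside`** (`|Pold − PoldIn| ≤ C·Zvol`) for a genuine one-scale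
polymer sum: with `Pold = Σ_Y 𝒫(Y, U)`, `PoldIn = Σ_{Y ⊂ Ω} 𝒫(Y, U)` and any `Zvol ≥ #(blocks ∖ Ω)` (e.g. `|Z_k|` in
unit-lattice sites), `|Pold − PoldIn| ≤ (C·g·K₀(c₀,Δ))·Zvol`. [cite: Balaban1985UV3, Thm 2 proof p.272] -/
theorem oldOutside_shape_of_bound25 (hΔ : G.DegreeLE Δ) (hV : G.VolumeLeaf c₀) (hκ : kappa₀ c₀ Δ ≤ κ)
    (act : S.Dom → Cfg → ℝ) (hCg : 0 ≤ C * g) (h25 : B10.Bound25Printed ⟨S.Dom, Cfg, S.dj, act⟩ g κ C) (U : Cfg)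
    (Ω : Finset G.Cube) {Zvol : ℝ} (hZ : ((Finset.univ \ Ω).card : ℝ) ≤ Zvol) :
    |∑ X : S.Dom, act X U - ∑ X ∈ Finset.univ.filter (fun X : S.Dom => G.cubes X ⊆ Ω), act X U|
      ≤ (C * g * K₀ c₀ Δ) * Zvol := by
  rw [sum_sub_sum_subset_eq G act U Ω]
  calc |∑ X ∈ Finset.univ.filter (fun X : S.Dom => ¬ G.cubes X ⊆ Ω), act X U|
      ≤ ∑ X ∈ Finset.univ.filter (fun X : S.Dom => ¬ G.cubes X ⊆ Ω), |act X U| := Finset.abs_sum_le_sum_abs _ _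
    _ ≤ C * g * K₀ c₀ Δ * (Finset.univ \ Ω).card := sum_abs_act_notSubset_le_of_bound25 G hΔ hV hκ act hCg h25 U Ω
    _ ≤ (C * g * K₀ c₀ Δ) * Zvol := mul_le_mul_of_nonneg_left hZ (mul_nonneg hCg (K₀_pos c₀ Δ).le)

end Bound25

/-! ## §3 The same without the quoted volume leaf (tree-length bound `𝓛(Y) ≥ ℓ₀(#blocks(Y) − 1)`) -/

section TreeLength

variable {S : LocDomainSys} (G : CubeSystem S) {Δ : ℕ} {κ g C ℓ₀ : ℝ} {Cfg : Type}

/-- `1 ≤ ℓ₀⁻¹` for `0 < ℓ₀ ≤ 1` (private arithmetic). [folklore] -/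
private theorem one_le_inv_of_le_one (hℓ₀ : 0 < ℓ₀) (hℓ₁ : ℓ₀ ≤ 1) : 1 ≤ ℓ₀⁻¹ := by
  rw [le_inv_comm₀ one_pos hℓ₀, inv_one]; exact hℓ₁

/-- **The touching sum WITHOUT the volume leaf:** under wall-degree ≤ Δ, the tree-length bound `𝓛(Y) ≥ ℓ₀(#blocks(Y) − 1)`
(p. 262 [8]: the big blocks are scaled to unit cubes, neighbouring centres at distance 1; `0 < ℓ₀ ≤ 1`) and
`κ ≥ κ₀(ℓ₀⁻¹,Δ)`, a (25)-type bound gives `Σ_{Y ∩ W ≠ ∅} |𝒫(Y,U)| ≤ C·g·K₀(ℓ₀⁻¹,Δ)·#W` — the auxiliary size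
`ℓ₀(#blocks − 1)` obeys the volume leaf with `c₀ = ℓ₀⁻¹` exactly (device of `B10Eq65PolymerSum` §7).
[cite: Balaban1985UV3, Thm 2 proof p.272 + (25) p.262] -/
theorem sum_abs_act_touching_le_treeLength (hΔ : G.DegreeLE Δ) (hℓ₀ : 0 < ℓ₀) (hℓ₁ : ℓ₀ ≤ 1)
    (hL : ∀ X : S.Dom, ℓ₀ * ((G.vol X : ℝ) - 1) ≤ S.dj X) (hκ : kappa₀ ℓ₀⁻¹ Δ ≤ κ)
    (act : S.Dom → Cfg → ℝ) (hCg : 0 ≤ C * g) (h25 : B10.Bound25Printed ⟨S.Dom, Cfg, S.dj, act⟩ g κ C) (U : Cfg)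
    (W : Finset G.Cube) :
    ∑ X ∈ Finset.univ.filter (fun X : S.Dom => (G.cubes X ∩ W).Nonempty), |act X U|
      ≤ C * g * K₀ ℓ₀⁻¹ Δ * W.card := by
  have hκ0 : 0 ≤ κ := (B12TreeDecay.kappa₀_nonneg (inv_pos.2 hℓ₀).le Δ).trans hκ
  -- the auxiliary system: same domains and blocks, size 𝓛′(Y) = ℓ₀(#blocks(Y) − 1)
  let S' : LocDomainSys :=
    { Dom := S.Dom
      dj := fun X => ℓ₀ * ((G.vol X : ℝ) - 1)
      dj_nonneg := fun X => by
        have h1 : (1 : ℝ) ≤ G.vol X := by exact_mod_cast G.vol_pos X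
        exact mul_nonneg hℓ₀.le (by linarith) }
  let G' : CubeSystem S' :=
    { Cube := G.Cube
      Adj := G.Adj
      adj_symm := G.adj_symm
      nbr := G.nbr
      mem_nbr := G.mem_nbr
      cubes := G.cubes
      cubes_injective := G.cubes_injective
      connected := G.connected }
  have hΔ' : G'.DegreeLE Δ := hΔ
  have hV' : G'.VolumeLeaf ℓ₀⁻¹ := by
    intro X
    change ((G.cubes X).card : ℝ) ≤ ℓ₀⁻¹ * (1 + ℓ₀ * (((G.cubes X).card : ℝ) - 1))
    have hinv := one_le_inv_of_le_one hℓ₀ hℓ₁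
    have hid : ℓ₀⁻¹ * (1 + ℓ₀ * (((G.cubes X).card : ℝ) - 1)) = ℓ₀⁻¹ + (((G.cubes X).card : ℝ) - 1) := by
      field_simp
    rw [hid]
    linarith
  have key : ∑ X ∈ Finset.univ.filter (fun X : S.Dom => (G.cubes X ∩ W).Nonempty),
      Real.exp (-κ * (ℓ₀ * ((G.vol X : ℝ) - 1))) ≤ K₀ ℓ₀⁻¹ Δ * W.card :=
    ineq126_touches G' hΔ' hV' hκ W
  calc ∑ X ∈ Finset.univ.filter (fun X : S.Dom => (G.cubes X ∩ W).Nonempty), |act X U|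
      ≤ ∑ X ∈ Finset.univ.filter (fun X : S.Dom => (G.cubes X ∩ W).Nonempty), C * g * Real.exp (-κ * S.dj X) :=
        Finset.sum_le_sum fun X _ => by rw [neg_mul]; exact h25 X U
    _ ≤ ∑ X ∈ Finset.univ.filter (fun X : S.Dom => (G.cubes X ∩ W).Nonempty),
          C * g * Real.exp (-κ * (ℓ₀ * ((G.vol X : ℝ) - 1))) :=
        Finset.sum_le_sum fun X _ => mul_le_mul_of_nonneg_left
          (Real.exp_le_exp.2 (by nlinarith [hL X])) hCg
    _ = C * g * ∑ X ∈ Finset.univ.filter (fun X : S.Dom => (G.cubes X ∩ W).Nonempty),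
          Real.exp (-κ * (ℓ₀ * ((G.vol X : ℝ) - 1))) := by rw [Finset.mul_sum]
    _ ≤ C * g * (K₀ ℓ₀⁻¹ Δ * W.card) := mul_le_mul_of_nonneg_left key hCg
    _ = C * g * K₀ ℓ₀⁻¹ Δ * W.card := by ring

/-- **The exactness sentence p. 272 at one scale, leaf-free form:** `Σ_{Y ⊄ Ω} |𝒫(Y, U)| ≤ C·g·K₀(ℓ₀⁻¹,Δ)·#(blocks ∖ Ω)`
from (25)-type decay, wall-degree ≤ Δ and `𝓛(Y) ≥ ℓ₀(#blocks(Y) − 1)`. [cite: Balaban1985UV3, Thm 2 proof p.272] -/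
theorem sum_abs_act_notSubset_le_treeLength (hΔ : G.DegreeLE Δ) (hℓ₀ : 0 < ℓ₀) (hℓ₁ : ℓ₀ ≤ 1)
    (hL : ∀ X : S.Dom, ℓ₀ * ((G.vol X : ℝ) - 1) ≤ S.dj X) (hκ : kappa₀ ℓ₀⁻¹ Δ ≤ κ)
    (act : S.Dom → Cfg → ℝ) (hCg : 0 ≤ C * g) (h25 : B10.Bound25Printed ⟨S.Dom, Cfg, S.dj, act⟩ g κ C) (U : Cfg)
    (Ω : Finset G.Cube) :
    ∑ X ∈ Finset.univ.filter (fun X : S.Dom => ¬ G.cubes X ⊆ Ω), |act X U|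
      ≤ C * g * K₀ ℓ₀⁻¹ Δ * (Finset.univ \ Ω).card := by
  rw [filter_notSubset_eq_filter_touches G Ω]
  exact sum_abs_act_touching_le_treeLength G hΔ hℓ₀ hℓ₁ hL hκ act hCg h25 U (Finset.univ \ Ω)

/-- **The `OldOutside` shape, leaf-free form:** `|Σ_Y 𝒫(Y,U) − Σ_{Y ⊂ Ω} 𝒫(Y,U)| ≤ (C·g·K₀(ℓ₀⁻¹,Δ))·Zvol` for any
`Zvol ≥ #(blocks ∖ Ω)`. [cite: Balaban1985UV3, Thm 2 proof p.272] -/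
theorem oldOutside_shape_treeLength (hΔ : G.DegreeLE Δ) (hℓ₀ : 0 < ℓ₀) (hℓ₁ : ℓ₀ ≤ 1)
    (hL : ∀ X : S.Dom, ℓ₀ * ((G.vol X : ℝ) - 1) ≤ S.dj X) (hκ : kappa₀ ℓ₀⁻¹ Δ ≤ κ)
    (act : S.Dom → Cfg → ℝ) (hCg : 0 ≤ C * g) (h25 : B10.Bound25Printed ⟨S.Dom, Cfg, S.dj, act⟩ g κ C) (U : Cfg)
    (Ω : Finset G.Cube) {Zvol : ℝ} (hZ : ((Finset.univ \ Ω).card : ℝ) ≤ Zvol) :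
    |∑ X : S.Dom, act X U - ∑ X ∈ Finset.univ.filter (fun X : S.Dom => G.cubes X ⊆ Ω), act X U|
      ≤ (C * g * K₀ ℓ₀⁻¹ Δ) * Zvol := by
  rw [sum_sub_sum_subset_eq G act U Ω]
  calc |∑ X ∈ Finset.univ.filter (fun X : S.Dom => ¬ G.cubes X ⊆ Ω), act X U|
      ≤ ∑ X ∈ Finset.univ.filter (fun X : S.Dom => ¬ G.cubes X ⊆ Ω), |act X U| := Finset.abs_sum_le_sum_abs _ _
    _ ≤ C * g * K₀ ℓ₀⁻¹ Δ * (Finset.univ \ Ω).card :=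
        sum_abs_act_notSubset_le_treeLength G hΔ hℓ₀ hℓ₁ hL hκ act hCg h25 U Ω
    _ ≤ (C * g * K₀ ℓ₀⁻¹ Δ) * Zvol := mul_le_mul_of_nonneg_left hZ (mul_nonneg hCg (K₀_pos _ Δ).le)

end TreeLength

/-! ## §4 (v1.1) All scales `j = 1, …, k`: the p. 272 sentence summed over the scales of (41), with the d = 3 power
counting of (45)–(46) p. 267 — the O(1)|Z_k| WRITTEN OUT -/

section AllScales

variable {Δ : ℕ} {c₀ κ C L M₁ CM g pg Zvol : ℝ} {Cfg : Type}

/-- Re-indexing of the scale sum: `Σ_{j=1}^{k} q^{k−j} = Σ_{m<k} q^m` (`m = k − j`; private copy of the device of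
`B10SectCExpansion`). [folklore] -/
private theorem sum_Icc_pow_sub_eq' (q : ℝ) (k : ℕ) :
    ∑ j ∈ Finset.Icc 1 k, q ^ (k - j) = ∑ m ∈ Finset.range k, q ^ m := by
  refine Finset.sum_nbij' (fun j => k - j) (fun m => k - m) ?_ ?_ ?_ ?_ ?_
  · intro j hj
    simp only [Finset.mem_Icc] at hj
    simp only [Finset.mem_range]
    omega
  · intro m hm
    simp only [Finset.mem_range] at hm
    simp only [Finset.mem_Icc]
    omega
  · intro j hj
    simp only [Finset.mem_Icc] at hj
    omega
  · intro m hm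
    simp only [Finset.mem_range] at hm
    omega
  · intro j _
    rfl

/-- **The exactness sentence of p. 272 OVER ALL SCALES of (41)** — *"To get the exact inequality we estimate a sum of
all terms 𝒫_j(Y_j, U_{k+1}) with localizations Y_j not contained in Ω_{k+1} by O(1)|Λ_k|, or by O(1)|Z_k|"* — with the
O(1) written out by the d = 3 power counting of p. 267 (*"Summation over y gives the factor (M₁L^jη)^{−3}|Λ_k|, and
finally summation over j = 1, …, k gives … (46)"*): for each scale `j = 1, …, k` a one-scale polymer system
(`S j`, `G j`; wall-degree ≤ Δ, volume leaf `c₀`, `κ ≥ κ₀(c₀,Δ)`) whose activities `𝒫_j(·, U)` obey the (25)/(44)-type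
bound WITH the scale-j smallness of (44)–(45), `|𝒫_j(Y, U)| ≤ C·(CM·g·p(g))²(L^jη)⁴·e^{−κ𝓛(Y)}` (`ℓ j = L^jη = L^{j−k}`),
and block sets `Ω_j` (the scale-j blocks of `Ω_{k+1}`) with `#(j-blocks ∖ Ω_j) ≤ (M₁L^jη)^{−3}·Zvol` (`Zvol = |Z_k|` in
unit-lattice sites), the dropped terms satisfy
`Σ_{j=1}^{k} |Σ_Y 𝒫_j(Y,U) − Σ_{Y ⊂ Ω_j} 𝒫_j(Y,U)| ≤ C·K₀(c₀,Δ)·CM²·M₁^{−3}·(L/(L−1))·(g p(g))²·Zvol` — the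
`OldOutside` shape `≤ O(1)|Z_k|` with `O(1) = O(M₁³g²p²(g))·K₀` (for `CM = O(1)M₁³` as in (45)), i.e. the absorption that
the cell census marks «not written» in print (pub-balaban GAPS G-B10-07 (b)), here in the decay-based reading of §2
(touching form of (1.26)) followed by `B10.powerCounting_d3` (`Σ_{j≤k} L^{j−k} ≤ L/(L−1)`).  One configuration `U`
for all scales (print: all at `U_{k+1}`). [cite: Balaban1985UV3, Thm 2 proof p.272 + (45)–(46) p.267] -/
theorem oldOutside_allScales_of_bound25 (k : ℕ) (S : ℕ → LocDomainSys) (G : ∀ j, CubeSystem (S j))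
    (act : ∀ j, (S j).Dom → Cfg → ℝ) (U : Cfg) (Ω : ∀ j, Finset (G j).Cube) (ℓ : ℕ → ℝ)
    (hL : 1 < L) (hM : 0 < M₁) (hC : 0 ≤ C) (hZ : 0 ≤ Zvol)
    (hℓ : ∀ j ∈ Finset.Icc 1 k, ℓ j = L⁻¹ ^ (k - j))
    (hΔ : ∀ j ∈ Finset.Icc 1 k, (G j).DegreeLE Δ) (hV : ∀ j ∈ Finset.Icc 1 k, (G j).VolumeLeaf c₀)
    (hκ : kappa₀ c₀ Δ ≤ κ)
    (h25 : ∀ j ∈ Finset.Icc 1 k,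
      B10.Bound25Printed ⟨(S j).Dom, Cfg, (S j).dj, act j⟩ ((CM * g * pg) ^ 2 * ℓ j ^ 4) κ C)
    (hcard : ∀ j ∈ Finset.Icc 1 k,
      (((Finset.univ : Finset (G j).Cube) \ Ω j).card : ℝ) ≤ (M₁ * ℓ j)⁻¹ ^ 3 * Zvol) :
    ∑ j ∈ Finset.Icc 1 k,
        |∑ X : (S j).Dom, act j X U -
          ∑ X ∈ Finset.univ.filter (fun X : (S j).Dom => (G j).cubes X ⊆ Ω j), act j X U|
      ≤ C * K₀ c₀ Δ * CM ^ 2 * M₁⁻¹ ^ 3 * (L / (L - 1)) * (g * pg) ^ 2 * Zvol := by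
  have hL0 : 0 < L := by linarith
  have hK₀ : 0 ≤ K₀ c₀ Δ := (K₀_pos c₀ Δ).le
  -- one scale: §2 with the scale-j smallness inside the (25)-type constant, then the block count
  have hlevel : ∀ j ∈ Finset.Icc 1 k,
      |∑ X : (S j).Dom, act j X U -
          ∑ X ∈ Finset.univ.filter (fun X : (S j).Dom => (G j).cubes X ⊆ Ω j), act j X U|
        ≤ C * K₀ c₀ Δ * CM ^ 2 * M₁⁻¹ ^ 3 * (g * pg) ^ 2 * Zvol * ℓ j := by
    intro j hj
    have hℓpos : 0 < ℓ j := by rw [hℓ j hj]; positivity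
    have hCg : 0 ≤ C * ((CM * g * pg) ^ 2 * ℓ j ^ 4) := by positivity
    calc |∑ X : (S j).Dom, act j X U -
            ∑ X ∈ Finset.univ.filter (fun X : (S j).Dom => (G j).cubes X ⊆ Ω j), act j X U|
        ≤ (C * ((CM * g * pg) ^ 2 * ℓ j ^ 4) * K₀ c₀ Δ) * ((M₁ * ℓ j)⁻¹ ^ 3 * Zvol) :=
          oldOutside_shape_of_bound25 (G j) (hΔ j hj) (hV j hj) hκ (act j) hCg (h25 j hj) U (Ω j) (hcard j hj)
      _ = C * K₀ c₀ Δ * CM ^ 2 * M₁⁻¹ ^ 3 * (g * pg) ^ 2 * Zvol * ℓ j := by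
          have hℓ0 : ℓ j ≠ 0 := hℓpos.ne'
          have hM0 : M₁ ≠ 0 := hM.ne'
          field_simp
  -- all scales: Σ_{j=1}^{k} L^{j−k} ≤ L/(L−1) (`B10.powerCounting_d3`)
  have hscale : ∑ j ∈ Finset.Icc 1 k, ℓ j ≤ L / (L - 1) := by
    calc ∑ j ∈ Finset.Icc 1 k, ℓ j = ∑ j ∈ Finset.Icc 1 k, L⁻¹ ^ (k - j) := Finset.sum_congr rfl hℓ
      _ = ∑ m ∈ Finset.range k, L⁻¹ ^ m := sum_Icc_pow_sub_eq' L⁻¹ k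
      _ ≤ L / (L - 1) := by simpa using B10.powerCounting_d3 L hL k
  have hK : 0 ≤ C * K₀ c₀ Δ * CM ^ 2 * M₁⁻¹ ^ 3 * (g * pg) ^ 2 * Zvol := by
    have : 0 ≤ M₁⁻¹ := inv_nonneg.mpr hM.le
    positivity
  calc ∑ j ∈ Finset.Icc 1 k,
          |∑ X : (S j).Dom, act j X U -
            ∑ X ∈ Finset.univ.filter (fun X : (S j).Dom => (G j).cubes X ⊆ Ω j), act j X U|
      ≤ ∑ j ∈ Finset.Icc 1 k, C * K₀ c₀ Δ * CM ^ 2 * M₁⁻¹ ^ 3 * (g * pg) ^ 2 * Zvol * ℓ j :=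
        Finset.sum_le_sum hlevel
    _ = C * K₀ c₀ Δ * CM ^ 2 * M₁⁻¹ ^ 3 * (g * pg) ^ 2 * Zvol * ∑ j ∈ Finset.Icc 1 k, ℓ j := by
        rw [Finset.mul_sum]
    _ ≤ C * K₀ c₀ Δ * CM ^ 2 * M₁⁻¹ ^ 3 * (g * pg) ^ 2 * Zvol * (L / (L - 1)) :=
        mul_le_mul_of_nonneg_left hscale hK
    _ = C * K₀ c₀ Δ * CM ^ 2 * M₁⁻¹ ^ 3 * (L / (L - 1)) * (g * pg) ^ 2 * Zvol := by ring

/-- **The printed shape of the all-scales bound:** with `CM = c_M·M₁³` (the O(M₁³) of (45)) the constant is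
`C·K₀·c_M²·(L/(L−1))·M₁³(g p(g))²` per unit of `Zvol` — *"O(1)M₁³g²_{k−1}p²(g_{k−1})"* of (46), *"not only convergent, but
also small"*. [cite: Balaban1985UV3, (46) p.267 + Thm 2 proof p.272] -/
theorem oldOutside_allScales_printed_shape {cM : ℝ} (hM : 0 < M₁) (hCM : CM = cM * M₁ ^ 3) :
    C * K₀ c₀ Δ * CM ^ 2 * M₁⁻¹ ^ 3 * (L / (L - 1)) * (g * pg) ^ 2 * Zvol =
      C * K₀ c₀ Δ * cM ^ 2 * (L / (L - 1)) * (M₁ ^ 3 * (g * pg) ^ 2) * Zvol := by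
  have hM0 : M₁ ≠ 0 := hM.ne'
  rw [hCM]
  field_simp

end AllScales

end Literature.MathematicalPhysics.QuantumFieldTheory.Balaban1983to89.B10Thm2Exactness

end
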